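import Summits.BirchSwinnertonDyer.Rank1Residual.P2.CongruentNumberSilentEvenFiveAokiSymbols
import HarnessLib

/-!
# Cell `bsd-monsky`: Aoki's data on EVERY even two-prime cell `n = 2pq ≡ 6 (mod 8)` (`p ≡ 1 (mod 4)`,
# `q ≡ 3 (mod 4)`) — the sets `S, T, S₁, S₂` and the Hilbert symbols for `p ≡ 1 (mod 4)` in general, and
# the `λ`-values on the `p ≡ 1 (mod 8)` cells (nothing asserted)

HONEST FRAMING (cell `bsd-monsky`, run/shared/lean/pub/bsd-monsky/, README §1: ONE theorem on ONE explicit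
infinite family of quadratic twists of the congruent number curve at the prime `2`; not "BSD for rank ≤ 1",
nothing at odd primes, nothing booked until the cross-family referee passes the written proof). This file
asserts NO arithmetic fact and carries NO named-fact binder: it extends the bookkeeping of
`P2/CongruentNumberSilentEvenFiveAokiSymbols.lean` (the `p ≡ 5 (mod 8)` cells) to the other residue class
`p ≡ 1 (mod 8)` of the `k = 2` rung of the typed even Monsky law (`P2/CongruentNumberPairsAtTwoEvenRungTwo.lean`:
the cells `n = 2pq ≡ 6 (mod 8)` are the ordered pairs `{p ≡ 1 (4), q ≡ 3 (4)}`), so that Aoki's Theorem 2.2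
(the named fact `Aoki1999.thm22_card_selmerGroup_two`, refereed and fully proved in print) can be EVALUATED on
every `k = 2` cell in the sequel `P2/CongruentNumberEvenPairSelmerAoki.lean`:

* §1 the finite sets for `p ≡ 1 (mod 4)`, `q ≡ 3 (mod 4)` (so `2pq ≡ 6 (mod 8)`): `S = {2, p, q}`, `T₁ = T = {p}`,
  `S₁ = {p, q}`, `S₂ = {q}` — the same sets as on the `p ≡ 5 (mod 8)` cells, now with the weaker hypothesis;
* §2 the Hilbert symbols `(−2pq, x)_ℓ`, `ℓ ∈ {p, q}`, `x ∈ {2, p, q}` for `p ≡ 1 (mod 4)` in general: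
  `(−2pq, 2)_p = (2/p)`, `(−2pq, p)_p = (2/p)(q/p)`, `(−2pq, q)_p = (q/p)`, `(−2pq, p)_q = (p/q)`,
  `(−2pq, q)_q = (2/q)(p/q)` (Serre's explicit formula, the tree's `localSign`);
* §3 Aoki's `λ ∈ ℤ/2ℤ` on the `p ≡ 1 (mod 8)` cells: `λ_p(2) = 0`, `λ₂(p) = 0` (`χ₈(p) = 1`),
  `λ_p(p) = 0 ↔ (q/p) = 1`, `λ_p(q) = 0 ↔ (q/p) = 1`, `λ_q(p) = 0 ↔ (p/q) = 1`, and `λ_q(q) = λ₂(q)` if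
  `(p/q) = 1`, `λ_q(q) = λ₂(q) + 1` if `(p/q) = −1`.

References: [Aoki1999] §2 pp. 79–81; [Serre1973] Ch. III §1.2 Thm. 1 (the tree's `localSign` lemmas);
[IrelandRosen1990] Ch. 5 §2 (Jacobi-symbol supplements and reciprocity, the tree's `HeathBrown1994.Families` lemmas).
-/

noncomputable section

open scoped Classical

open WeierstrassCurve Literature.NumberTheory.EllipticCurves
  Literature.NumberTheory.EllipticCurves.Aoki1999
  Literature.NumberTheory.EllipticCurves.HeathBrown1994.Families
  Literature.NumberTheory.QuadraticForms

set_option autoImplicit false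

namespace Summit.BirchSwinnertonDyer.Rank1Residual.P2

section EvenPair

variable {p q : ℕ}

/-! ## §1 The sets `S, T₁, T, S₁, S₂` on `n = 2pq`, `p ≡ 1 (mod 4)`, `q ≡ 3 (mod 4)` -/

/-- `2pq ≡ 6 (mod 8)` for `p ≡ 1 (mod 4)`, `q ≡ 3 (mod 4)`. [folklore] -/
theorem two_mul_pair_mod_eight (hp4 : p % 4 = 1) (hq4 : q % 4 = 3) : (2 * (p * q)) % 8 = 6 := by
  have hp8 : p % 8 = 1 ∨ p % 8 = 5 := by omega
  have hq8 : q % 8 = 3 ∨ q % 8 = 7 := by omega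
  rw [Nat.mul_mod, Nat.mul_mod p q]
  rcases hp8 with h | h <;> rcases hq8 with h' | h' <;> rw [h, h']

/-- `T₁ = {p}` for `n = 2pq`, `p ≡ 1 (mod 4)`, `q ≡ 3 (mod 4)`. [cite: Aoki1999, §2 p. 80] -/
theorem tOneSet_two_mul_pair (hp : p.Prime) (hq : q.Prime) (hp4 : p % 4 = 1) (hq4 : q % 4 = 3) :
    tOneSet (2 * (p * q)) = {p} := by
  unfold tOneSet
  rw [sSet_two_mul_five_mul hp hq]
  ext x
  simp only [Finset.mem_filter, Finset.mem_insert, Finset.mem_singleton]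
  constructor
  · rintro ⟨rfl | rfl | rfl, h⟩ <;> omega
  · rintro rfl
    exact ⟨Or.inr (Or.inl rfl), hp4⟩

/-- `T = T₁ = {p}` for `n = 2pq ≡ 6 (mod 8)`. [cite: Aoki1999, §2 p. 80] -/
theorem tSet_two_mul_pair (hp : p.Prime) (hq : q.Prime) (hp4 : p % 4 = 1) (hq4 : q % 4 = 3) :
    tSet (2 * (p * q)) = {p} := by
  unfold tSet
  rw [if_neg (by rw [two_mul_pair_mod_eight hp4 hq4]; omega), tOneSet_two_mul_pair hp hq hp4 hq4]

/-- `S₁ = {p, q}` for `n = 2pq`. [cite: Aoki1999, §2 p. 80] -/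
theorem sOneSet_two_mul_pair (hp : p.Prime) (hq : q.Prime) (hp4 : p % 4 = 1) (hq4 : q % 4 = 3) :
    sOneSet (2 * (p * q)) = {p, q} := by
  unfold sOneSet
  rw [sSet_two_mul_five_mul hp hq]
  ext x
  simp only [Finset.mem_filter, Finset.mem_insert, Finset.mem_singleton]
  constructor
  · rintro ⟨rfl | rfl | rfl, h⟩
    · exact absurd rfl h
    · exact Or.inl rfl
    · exact Or.inr rfl
  · rintro (rfl | rfl)
    · exact ⟨Or.inr (Or.inl rfl), by omega⟩
    · exact ⟨Or.inr (Or.inr rfl), by omega⟩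

/-- `S₂ = S₁ ∖ T = {q}` for `n = 2pq`. [cite: Aoki1999, Thm. 2.2 p. 81] -/
theorem sTwoSet_two_mul_pair (hp : p.Prime) (hq : q.Prime) (hp4 : p % 4 = 1) (hq4 : q % 4 = 3) :
    sTwoSet (2 * (p * q)) = {q} := by
  unfold sTwoSet
  rw [sOneSet_two_mul_pair hp hq hp4 hq4, tSet_two_mul_pair hp hq hp4 hq4]
  ext x
  simp only [Finset.mem_sdiff, Finset.mem_insert, Finset.mem_singleton]
  constructor
  · rintro ⟨rfl | rfl, h⟩
    · exact absurd rfl h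
    · rfl
  · rintro rfl
    exact ⟨Or.inr rfl, by omega⟩

/-! ## §2 The Hilbert symbols `(−2pq, x)_ℓ` for `p ≡ 1 (mod 4)`, `q ≡ 3 (mod 4)` (integer signs) -/

/-- `(−2pq, 2)_p = (2/p)` for `p ≡ 1 (mod 4)`. [cite: Serre1973, Ch. III §1.2 Thm. 1] -/
theorem localSign_prime_neg_n_two' (hp : p.Prime) (hq : q.Prime) (hp4 : p % 4 = 1) (hq4 : q % 4 = 3) :
    localSign p (-((2 * (p * q) : ℕ) : ℤ)) 2 = jacobiSym 2 p := by
  haveI : Fact p.Prime := ⟨hp⟩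
  have h2 : p ≠ 2 := by omega
  have hne : p ≠ q := fun h => by omega
  have e1 : localSign p p 2 = legendreSym p 2 := by
    rw [localSign_comm]
    exact localSign_odd_unit_prime h2 (not_dvd_two_of_prime_ne_two hp h2)
  have e2 : localSign p (-(2 * (q : ℤ))) 2 = 1 :=
    localSign_odd_unit_unit h2 (not_dvd_neg_two_mul hp hq h2 hne) (not_dvd_two_of_prime_ne_two hp h2)
  rw [(neg_two_mul_five_mul_eq p q).1,
    localSign_mul_left p (by exact_mod_cast hp.ne_zero) (by norm_cast; omega) two_ne_zero, e1, e2,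
    mul_one, jacobiSym.legendreSym.to_jacobiSym]

/-- `(−2pq, p)_p = (p, p)_p (−2q, p)_p = (−1/p)·(−2q/p) = (2/p)(q/p)` for `p ≡ 1 (mod 4)`.
[cite: Serre1973, Ch. III §1.2 Thm. 1] -/
theorem localSign_prime_neg_n_prime' (hp : p.Prime) (hq : q.Prime) (hp4 : p % 4 = 1) (hq4 : q % 4 = 3) :
    localSign p (-((2 * (p * q) : ℕ) : ℤ)) p = jacobiSym 2 p * jacobiSym q p := by
  haveI : Fact p.Prime := ⟨hp⟩
  have h2 : p ≠ 2 := by omega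
  have hne : p ≠ q := fun h => by omega
  have hpp : localSign p p p = 1 := by
    unfold localSign
    rw [if_neg h2, localSignOdd_self_self, ZMod.χ₄_nat_eq_if_mod_four]
    simp [show p % 2 = 1 by omega, hp4]
  have e2 : localSign p (-(2 * (q : ℤ))) p = legendreSym p (-(2 * (q : ℤ))) :=
    localSign_odd_unit_prime h2 (not_dvd_neg_two_mul hp hq h2 hne)
  rw [(neg_two_mul_five_mul_eq p q).1,
    localSign_mul_left p (by exact_mod_cast hp.ne_zero) (by norm_cast; omega)
      (by exact_mod_cast hp.ne_zero), hpp, e2, one_mul, jacobiSym.legendreSym.to_jacobiSym,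
    show (-(2 * (q : ℤ))) = (-1) * 2 * (q : ℤ) by ring, jacobiSym.mul_left, jacobiSym.mul_left,
    jacobiSym_neg_one_eq_one hp4, one_mul]

/-- `(−2pq, q)_p = (p, q)_p (−2q, q)_p = (q/p)` for `p ≡ 1 (mod 4)`. [cite: Serre1973, Ch. III §1.2 Thm. 1] -/
theorem localSign_prime_neg_n_other' (hp : p.Prime) (hq : q.Prime) (hp4 : p % 4 = 1) (hq4 : q % 4 = 3) :
    localSign p (-((2 * (p * q) : ℕ) : ℤ)) q = jacobiSym q p := by
  haveI : Fact p.Prime := ⟨hp⟩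
  have h2 : p ≠ 2 := by omega
  have hne : p ≠ q := fun h => by omega
  have e1 : localSign p p q = legendreSym p q := by
    rw [localSign_comm]
    exact localSign_odd_unit_prime h2 (not_dvd_of_ne hp hq hne)
  have e2 : localSign p (-(2 * (q : ℤ))) q = 1 :=
    localSign_odd_unit_unit h2 (not_dvd_neg_two_mul hp hq h2 hne) (not_dvd_of_ne hp hq hne)
  rw [(neg_two_mul_five_mul_eq p q).1,
    localSign_mul_left p (by exact_mod_cast hp.ne_zero) (by norm_cast; omega)
      (by exact_mod_cast hq.ne_zero), e1, e2, mul_one, jacobiSym.legendreSym.to_jacobiSym]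

/-- `(−2pq, p)_q = (q, p)_q (−2p, p)_q = (p/q)` for `p ≡ 1 (mod 4)`. [cite: Serre1973, Ch. III §1.2 Thm. 1] -/
theorem localSign_other_neg_n_prime' (hp : p.Prime) (hq : q.Prime) (hp4 : p % 4 = 1) (hq4 : q % 4 = 3) :
    localSign q (-((2 * (p * q) : ℕ) : ℤ)) p = jacobiSym p q := by
  haveI : Fact q.Prime := ⟨hq⟩
  have h2 : q ≠ 2 := by omega
  have hne : q ≠ p := fun h => by omega
  have e1 : localSign q q p = legendreSym q p := by
    rw [localSign_comm]
    exact localSign_odd_unit_prime h2 (not_dvd_of_ne hq hp hne)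
  have e2 : localSign q (-(2 * (p : ℤ))) p = 1 :=
    localSign_odd_unit_unit h2 (not_dvd_neg_two_mul hq hp h2 hne) (not_dvd_of_ne hq hp hne)
  rw [(neg_two_mul_five_mul_eq p q).2,
    localSign_mul_left q (by exact_mod_cast hq.ne_zero) (by norm_cast; omega)
      (by exact_mod_cast hp.ne_zero), e1, e2, mul_one, jacobiSym.legendreSym.to_jacobiSym]

/-- `(−2pq, q)_q = (q, q)_q (−2p, q)_q = (−1/q)·(−1/q)(2/q)(p/q) = (2/q)(p/q)` for `p ≡ 1 (mod 4)`,
`q ≡ 3 (mod 4)`. [cite: Serre1973, Ch. III §1.2 Thm. 1] -/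
theorem localSign_other_neg_n_other' (hp : p.Prime) (hq : q.Prime) (hp4 : p % 4 = 1) (hq4 : q % 4 = 3) :
    localSign q (-((2 * (p * q) : ℕ) : ℤ)) q = jacobiSym 2 q * jacobiSym p q := by
  haveI : Fact q.Prime := ⟨hq⟩
  have h2 : q ≠ 2 := by omega
  have hne : q ≠ p := fun h => by omega
  have hqq : localSign q q q = -1 := by
    unfold localSign
    rw [if_neg h2, localSignOdd_self_self, ZMod.χ₄_nat_eq_if_mod_four]
    simp [show q % 2 = 1 by omega, hq4]
  have hneg : jacobiSym (-1) q = -1 := by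
    rw [jacobiSym.at_neg_one (Nat.odd_iff.mpr (by omega)), ZMod.χ₄_nat_eq_if_mod_four]
    simp [show q % 2 = 1 by omega, hq4]
  have e2 : localSign q (-(2 * (p : ℤ))) q = legendreSym q (-(2 * (p : ℤ))) :=
    localSign_odd_unit_prime h2 (not_dvd_neg_two_mul hq hp h2 hne)
  rw [(neg_two_mul_five_mul_eq p q).2,
    localSign_mul_left q (by exact_mod_cast hq.ne_zero) (by norm_cast; omega)
      (by exact_mod_cast hq.ne_zero), hqq, e2, jacobiSym.legendreSym.to_jacobiSym,
    show (-(2 * (p : ℤ))) = (-1) * 2 * (p : ℤ) by ring, jacobiSym.mul_left, jacobiSym.mul_left, hneg]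
  ring

/-! ## §3 Aoki's additive symbols `λ_ℓ(x) ∈ ℤ/2ℤ` on the `p ≡ 1 (mod 8)` cells -/

/-- `λ_p(2) = 0` (`(2/p) = 1` for `p ≡ 1 (mod 8)`). [cite: Aoki1999, §2 p. 79] -/
theorem lam_prime_two_one (hp : p.Prime) (hq : q.Prime) (hp1 : p % 8 = 1) (hq4 : q % 4 = 3) :
    lam (2 * (p * q)) p 2 = 0 := by
  haveI : Fact p.Prime := ⟨hp⟩
  rw [lam_of_ne_two hp (by omega), hilbertBit_eq_zero_iff (neg_two_mul_five_mul_ne_zero hp hq) two_ne_zero,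
    localSign_prime_neg_n_two' hp hq (by omega) hq4]
  exact jacobiSym_two_eq_one (Or.inl hp1)

/-- `λ₂(p) = 0` for `p ≡ 1 (mod 8)` (`χ₈(1) = 1`). [cite: Aoki1999, §2 p. 79] -/
theorem lam_two_prime_one (hp : p.Prime) (hp1 : p % 8 = 1) (n : ℕ) : lam n 2 p = 0 := by
  rw [lam_two, hilbertBit_eq_zero_iff two_ne_zero (by exact_mod_cast hp.ne_zero),
    localSign_two_two_odd hp (by omega)]
  exact jacobiSym_two_eq_one (Or.inl hp1)

/-- `λ_p(p) = 0 ↔ (q/p) = 1` for `p ≡ 1 (mod 8)` (`(−2pq, p)_p = (2/p)(q/p) = (q/p)`). [cite: Aoki1999, §2 p. 79] -/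
theorem lam_prime_prime_eq_zero_iff' (hp : p.Prime) (hq : q.Prime) (hp1 : p % 8 = 1) (hq4 : q % 4 = 3) :
    lam (2 * (p * q)) p p = 0 ↔ jacobiSym q p = 1 := by
  haveI : Fact p.Prime := ⟨hp⟩
  rw [lam_of_ne_two hp (by omega), hilbertBit_eq_zero_iff (neg_two_mul_five_mul_ne_zero hp hq)
    (by exact_mod_cast hp.ne_zero), localSign_prime_neg_n_prime' hp hq (by omega) hq4,
    jacobiSym_two_eq_one (Or.inl hp1), one_mul]

/-- `λ_p(q) = 0 ↔ (q/p) = 1` for `p ≡ 1 (mod 4)`. [cite: Aoki1999, §2 p. 79] -/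
theorem lam_prime_other_eq_zero_iff' (hp : p.Prime) (hq : q.Prime) (hp4 : p % 4 = 1) (hq4 : q % 4 = 3) :
    lam (2 * (p * q)) p q = 0 ↔ jacobiSym q p = 1 := by
  haveI : Fact p.Prime := ⟨hp⟩
  rw [lam_of_ne_two hp (by omega), hilbertBit_eq_zero_iff (neg_two_mul_five_mul_ne_zero hp hq)
    (by exact_mod_cast hq.ne_zero), localSign_prime_neg_n_other' hp hq hp4 hq4]

/-- `λ_q(p) = 0 ↔ (p/q) = 1` for `p ≡ 1 (mod 4)`. [cite: Aoki1999, §2 p. 79] -/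
theorem lam_other_prime_eq_zero_iff' (hp : p.Prime) (hq : q.Prime) (hp4 : p % 4 = 1) (hq4 : q % 4 = 3) :
    lam (2 * (p * q)) q p = 0 ↔ jacobiSym p q = 1 := by
  haveI : Fact q.Prime := ⟨hq⟩
  rw [lam_of_ne_two hq (by omega), hilbertBit_eq_zero_iff (neg_two_mul_five_mul_ne_zero hp hq)
    (by exact_mod_cast hp.ne_zero), localSign_other_neg_n_prime' hp hq hp4 hq4]

/-- `λ_q(q) = λ₂(q)` when `(p/q) = 1` (both are the bit of `(2/q)`), for `p ≡ 1 (mod 4)`. [cite: Aoki1999, §2 p. 79] -/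
theorem lam_other_other_eq_lam_two' (hp : p.Prime) (hq : q.Prime) (hp4 : p % 4 = 1) (hq4 : q % 4 = 3)
    (hj : jacobiSym p q = 1) : lam (2 * (p * q)) q q = lam (2 * (p * q)) 2 q := by
  haveI : Fact q.Prime := ⟨hq⟩
  rw [lam_of_ne_two hq (by omega), lam_two, hilbertBit_eq_of_localSign (neg_two_mul_five_mul_ne_zero hp hq)
    (by exact_mod_cast hq.ne_zero), hilbertBit_eq_of_localSign two_ne_zero
    (by exact_mod_cast hq.ne_zero), localSign_other_neg_n_other' hp hq hp4 hq4, hj, mul_one,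
    localSign_two_two_odd hq (by omega)]

/-- `λ_q(q) = λ₂(q) + 1` when `(p/q) = −1` (the bits of `−(2/q)` and `(2/q)`), for `p ≡ 1 (mod 4)`.
[cite: Aoki1999, §2 p. 79] -/
theorem lam_other_other_eq_lam_two_add_one (hp : p.Prime) (hq : q.Prime) (hp4 : p % 4 = 1)
    (hq4 : q % 4 = 3) (hj : jacobiSym p q = -1) :
    lam (2 * (p * q)) q q = lam (2 * (p * q)) 2 q + 1 := by
  haveI : Fact q.Prime := ⟨hq⟩
  have h2q : jacobiSym 2 q = 1 ∨ jacobiSym 2 q = -1 := by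
    have hq8 : q % 8 = 3 ∨ q % 8 = 7 := by omega
    rcases hq8 with h | h
    · exact Or.inr (jacobiSym_two_eq_neg_one (Or.inl h))
    · exact Or.inl (jacobiSym_two_eq_one (Or.inr h))
  have hqq : localSign q (-((2 * (p * q) : ℕ) : ℤ)) q = -jacobiSym 2 q := by
    rw [localSign_other_neg_n_other' hp hq hp4 hq4, hj]; ring
  have h22 : localSign 2 2 q = jacobiSym 2 q := localSign_two_two_odd hq (by omega)
  rw [lam_of_ne_two hq (by omega), lam_two]
  rcases h2q with h | h
  · rw [hilbertBit_eq_one_iff (neg_two_mul_five_mul_ne_zero hp hq) (by exact_mod_cast hq.ne_zero) |>.mpr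
      (by rw [hqq, h]),
      hilbertBit_eq_zero_iff two_ne_zero (by exact_mod_cast hq.ne_zero) |>.mpr (by rw [h22, h])]
    decide
  · rw [hilbertBit_eq_zero_iff (neg_two_mul_five_mul_ne_zero hp hq) (by exact_mod_cast hq.ne_zero) |>.mpr
      (by rw [hqq, h]; norm_num),
      hilbertBit_eq_one_iff two_ne_zero (by exact_mod_cast hq.ne_zero) |>.mpr (by rw [h22, h])]
    decide

end EvenPair

end Summit.BirchSwinnertonDyer.Rank1Residual.P2

end
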